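/-
Copyright (c) 2026 the pub-hodgecm-mathlib formalisation cell (harness21).  Prover seat hodgecm-mathlib-R90-C10-p06 (g3), R90-TF SLAB section S1 «Ch10-local» (base
R90-C10), h413 = `stmt-HodgeConjecture-24833`; line «B_pos», RAMIFIED corner (B-10) (census `R90/R90-C10-p08/g2/CENSUS-Bpos-ramified-posdepth.md` 3c8eaa3bd4b223c1 §5 (7a) ∕
§6 (a)): brick (B-10)(7a) «THE CONVERSION AT POSITIVE DEPTH» — the Z5-ram step of ★ p862229 with the depth-zero letters `hdepth`, `hram` replaced by the sub-branch letter
«`χ₁ ≠ 1` on some `σ`-fixed unit».  2026-09-05.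
-/
import Summits.HodgeConjecture.HodgeConjecture.Theorems.R90S1KeysThmTwoDepthZeroBranchBConversionRamified   -- ★ p862229 (R90-C10-p05 (g0)): the d0 twin (template); brings ★ `isQuadraticCharExtension_of_forall_norm_of_exists_fixed`, ★ `exists_uniformizer_zpow_mul`, ★ `halfModulusChar_eq_one_of_forall_v_eq_one`, ★ `continuous_halfModulusChar_apply`, ★ `mem_unitsIntegers_iff`, ★ `valued_conjLocal_apply_of_smul_eq`
import HarnessLib

/-!
# R90-TF S1 «Ch10-local» ∕ K2 E3 «U4Keys» :182, BRANCH B AT POSITIVE DEPTH, RAMIFIED corner — brick (B-10)(7a): THE CONVERSION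
# «Branch B + the admissible root `χ₁(σΠ·Π) = ‖σΠ·Π‖^{1∕2}` + ONE `σ`-fixed unit of absolute value one on which `χ₁ ≠ 1` ⟹ `χ₁ = η·‖·‖^{1∕2}` with `η` a quadratic-extension character»
# [Keys1984 §7 Thm (2) (d); Rogawski1990 §12.2 (2), §4.8; Serre1979 Ch. V §3]

Cell `pub/hodgecm-mathlib`, crux H413 = `stmt-HodgeConjecture-24833`, route of record `HCCMUnconditional` (no route verbs); R90-TF section S1 (junction socket A2′ = U4Keys :217,
REL over :155 and :182).  THEOREMS ONLY (no `def`, no `instance`, no `notation`, no named-fact hypothesis, no `sorry`); lane `--supports stmt-HodgeConjecture-24833 --as helper`,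
count-neutral.  NOT THE PAYER of :182.  FRAME = ★ p862229's: `(L v) (hns : ∀ w, c • w = w) (w) (hw)`, a uniformiser unit `piU` of `R = L ⊗ L⁺_v` (`|Π_{w′}| = exp(−1)`), `χ₁ : Rˣ →* ℂˣ`
continuous, `hB` (`χ₁(u·σu) = 1` on units of absolute value one), `hroot` (`χ₁(σΠ·Π) = halfModulusChar(σΠ·Π)`).

THE POINT (census §6 (a)).  ★ p862229 `exists_eta_of_branchB_of_apply_norm_uniformizer_ramified` carries the DEPTH-ZERO letters `hdepth` (trivial on principal units) and `hram`
(non-trivial on the integral units), used ONLY in its step (ii) to manufacture a `σ`-fixed unit on which `η := χ₁·‖·‖^{−1∕2}` is non-trivial (via `σ_w ≡ id (mod 𝔭_w)` and `|2|_w = 1`).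
At POSITIVE depth `hdepth` is false; in the sub-branch (R-b) of the ramified corner (`χ₁|_{𝒪_F^×} = ε ≠ 1`) that unit IS the sub-branch letter.  This file restates the conversion
with `hdepth hram he h2w` replaced by ONE letter **`hFε : ∃ a : Rˣ, (c ⊗ 1) a = a ∧ (∀ w′, |a_{w′}| = 1) ∧ χ₁ a ≠ 1`**; steps (i) («`η` kills every norm `σ(y)·y`»: `y = Πⁿ·u` ★
`exists_uniformizer_zpow_mul`, `hroot`, `hB`, ★ `halfModulusChar_eq_one_of_forall_v_eq_one`) and (iii) (★ `isQuadraticCharExtension_of_forall_norm_of_exists_fixed`, continuity,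
`χ₁ = η·‖·‖^{1∕2}`) are ★ p862229's VERBATIM; step (ii) is `hFε` itself (`η a = χ₁ a` on a unit of absolute value one).  No ramification, tameness or depth hypothesis remains: the
statement holds at every non-split place.
* **`exists_eta_of_branchB_of_apply_norm_uniformizer_of_fixedUnit`** — `∃ η, IsQuadraticCharExtension σ η ∧ Continuous η ∧ χ₁ = η · halfModulusChar` (the leaf's second disjunct
  VERBATIM, as in ★ p862229).
HONEST LABEL.  HC_CM is proved only modulo the 7 printed citations (2 remaining named inputs: hLiu418 = `stmt-HodgeConjecture-24832`, h413 = `stmt-HodgeConjecture-24833`) until rung 0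
closes; count-neutral — this file does NOT pay :182 or A2′; no printed citation is discharged; the ramified Casselman pair at positive depth ((B-10)(5)–(7), P-ram-1) is untyped.

## References
* [Keys1984] D. Keys, *Principal series representations of special unitary groups over local fields*, Compositio Math. 51 (1984), §7 Theorem (2) (d) p. 126.
* [Rogawski1990] J. D. Rogawski, *Automorphic Representations of Unitary Groups in Three Variables*, Ann. of Math. Stud. 123 (1990), §12.2 (2) p. 173; §4.8 p. 51.
* [Serre1979] J.-P. Serre, *Local Fields*, GTM 67 (1979), Ch. V §3 Prop. 5 Cor. 3 (norm index two), Ch. XIV §2.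
-/

set_option autoImplicit false
-- the mandated namespace has the single-problem summit's repeated segment (`HodgeConjecture.HodgeConjecture`)
set_option linter.dupNamespace false

noncomputable section

open NumberField IsDedekindDomain
open Literature.NumberTheory.Automorphic Literature.NumberTheory.Automorphic.UnitaryGroup
open Summit.HodgeConjecture.HodgeConjecture.Cruxes.H413

namespace Summit.HodgeConjecture.HodgeConjecture.R90.S1.BposRamConversion

variable (L : Type) [Field L] [NumberField L] [IsCMField L] (v : HeightOneSpectrum (𝓞 ↥(maximalRealSubfield L)))
  (hns : ∀ w : PlacesOver L v, IsCMField.complexConj L • w.1 = w.1) (w : PlacesOver L v)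

include hns in
/-- **THE CONVERSION (Keys §7 Thm (2) (d)), BRANCH B, POSITIVE-DEPTH LETTERS.**  `v` non-split (`hns`, `hw`), `Π` a uniformiser unit of `R = L ⊗ L⁺_v` (`|Π_{w′}| = exp(−1)`), `χ₁`
continuous with `hB` (`χ₁(u·σu) = 1` on units of absolute value one), the sub-branch letter `hFε` (a `(c ⊗ 1)`-fixed unit `a` of absolute value one with `χ₁ a ≠ 1`) and the root
`hroot : χ₁(σΠ·Π) = ‖σΠ·Π‖^{1∕2}`.  Then `∃ η, IsQuadraticCharExtension σ η ∧ Continuous η ∧ χ₁ = η · halfModulusChar` (`η := χ₁·‖·‖^{−1∕2}` kills all norms — ★ p862229 step (i)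
verbatim — and `η a = χ₁ a ≠ 1`; then the norm index is `≤ 2`, ★ `isQuadraticCharExtension_of_forall_norm_of_exists_fixed`). [cite: Keys1984, §7 Theorem (2) (d) p. 126]
[cite: Rogawski1990, §12.2 (2) p. 173; §4.8 p. 51] [cite: Serre1979, Ch. V §3 Prop. 5 Cor. 3] -/
theorem exists_eta_of_branchB_of_apply_norm_uniformizer_of_fixedUnit (hw : IsCMField.complexConj L • w.1 = w.1)
    (piU : (LocalRing L v)ˣ) (hpiU : ∀ w' : PlacesOver L v, Valued.v ((piU : LocalRing L v) w') = WithZero.exp (-1 : ℤ))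
    (χ₁ : (LocalRing L v)ˣ →* ℂˣ) (h₁ : Continuous (fun x => ((χ₁ x : ℂˣ) : ℂ)))
    (hB : ∀ u : (LocalRing L v)ˣ, (∀ w' : PlacesOver L v, Valued.v ((u : LocalRing L v) w') = 1) →
      χ₁ (u * Units.map (conjLocal L (IsCMField.complexConj L) v : LocalRing L v →* LocalRing L v) u) = 1)
    (hFε : ∃ a : (LocalRing L v)ˣ, Units.map (conjLocal L (IsCMField.complexConj L) v : LocalRing L v →* LocalRing L v) a = a ∧
      (∀ w' : PlacesOver L v, Valued.v ((a : LocalRing L v) w') = 1) ∧ χ₁ a ≠ 1)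
    (hroot : χ₁ (Units.map (conjLocal L (IsCMField.complexConj L) v : LocalRing L v →* LocalRing L v) piU * piU) =
      halfModulusChar (LocalRing L v) (Units.map (conjLocal L (IsCMField.complexConj L) v : LocalRing L v →* LocalRing L v) piU * piU)) :
    ∃ η : (LocalRing L v)ˣ →* ℂˣ, IsQuadraticCharExtension (conjLocal L (IsCMField.complexConj L) v) η ∧
      Continuous (fun x => ((η x : ℂˣ) : ℂ)) ∧ χ₁ = η * halfModulusChar (LocalRing L v) := by
  classical
  haveI : Subsingleton (PlacesOver L v) :=
    PlacesOver.subsingleton_of_smul_eq (IsCMField.complexConj L) (IsCMField.complexConj_ne_one L) w hw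
  haveI : Algebra.IsQuadraticExtension ↥(maximalRealSubfield L) L := IsCMField.isQuadraticExtension L
  set η : (LocalRing L v)ˣ →* ℂˣ := χ₁ * (halfModulusChar (LocalRing L v))⁻¹ with hηdef
  have hηapp : ∀ x, η x = χ₁ x * (halfModulusChar (LocalRing L v) x)⁻¹ := fun x => by rw [hηdef, MonoidHom.mul_apply, MonoidHom.inv_apply]
  -- the unit-integer currency
  have hmodU : ∀ u : (LocalRing L v)ˣ, (∀ w' : PlacesOver L v, Valued.v ((u : LocalRing L v) w') = 1) → halfModulusChar (LocalRing L v) u = 1 :=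
    fun u hu => halfModulusChar_eq_one_of_forall_v_eq_one L v u hu
  have hσU : ∀ u : (LocalRing L v)ˣ, (∀ w' : PlacesOver L v, Valued.v ((u : LocalRing L v) w') = 1) →
      ∀ w' : PlacesOver L v, Valued.v ((Units.map (conjLocal L (IsCMField.complexConj L) v : LocalRing L v →* LocalRing L v) u : LocalRing L v) w') = 1 := by
    intro u hu w'
    rw [Units.coe_map, MonoidHom.coe_coe, valued_conjLocal_apply_of_smul_eq L v w' (hns w') (u : LocalRing L v)]
    exact hu w'
  -- (i) `η` kills every norm `σ(y)·y` (★ p862229 step (i) verbatim)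
  have key : ∀ (A B : (LocalRing L v)ˣ) (n : ℤ), χ₁ A = halfModulusChar (LocalRing L v) A → χ₁ B = halfModulusChar (LocalRing L v) B → η (A ^ n * B) = 1 := by
    intro A B n hA hB'
    rw [hηapp, map_mul, map_zpow, map_mul, map_zpow, hA, hB', mul_inv_cancel]
  have hN : ∀ y : (LocalRing L v)ˣ, η (Units.map (conjLocal L (IsCMField.complexConj L) v : LocalRing L v →* LocalRing L v) y * y) = 1 := by
    intro y
    obtain ⟨n, u, hu, hy, -⟩ := K2E3NonUnitaryCharacterDichotomy.exists_uniformizer_zpow_mul L v hns piU hpiU y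
    have hu1 : ∀ w' : PlacesOver L v, Valued.v ((u : LocalRing L v) w') = 1 := (F0P3cStCharTSTorusCompactPart.mem_unitsIntegers_iff L v u).1 hu
    have hNu1 : ∀ w' : PlacesOver L v,
        Valued.v (((Units.map (conjLocal L (IsCMField.complexConj L) v : LocalRing L v →* LocalRing L v) u * u : (LocalRing L v)ˣ) : LocalRing L v) w') = 1 := by
      intro w'
      rw [Units.val_mul, Pi.mul_apply, map_mul, hσU u hu1 w', hu1 w', mul_one]
    have hχNu : χ₁ (Units.map (conjLocal L (IsCMField.complexConj L) v : LocalRing L v →* LocalRing L v) u * u) =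
        halfModulusChar (LocalRing L v) (Units.map (conjLocal L (IsCMField.complexConj L) v : LocalRing L v →* LocalRing L v) u * u) := by
      rw [hmodU _ hNu1, mul_comm]; exact hB u hu1
    have hfact : Units.map (conjLocal L (IsCMField.complexConj L) v : LocalRing L v →* LocalRing L v) y * y =
        (Units.map (conjLocal L (IsCMField.complexConj L) v : LocalRing L v →* LocalRing L v) piU * piU) ^ n *
          (Units.map (conjLocal L (IsCMField.complexConj L) v : LocalRing L v →* LocalRing L v) u * u) := by
      rw [hy, map_mul, map_zpow, mul_mul_mul_comm, ← mul_zpow]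
    rw [hfact]
    exact key _ _ n hroot hχNu
  -- (ii) `η` is non-trivial on the `σ`-fixed unit of the letter `hFε`
  have hx : ∃ x₀ : (LocalRing L v)ˣ, conjLocal L (IsCMField.complexConj L) v (x₀ : LocalRing L v) = x₀ ∧ η x₀ ≠ 1 := by
    obtain ⟨a, haσ, ha1, hχa⟩ := hFε
    refine ⟨a, ?_, ?_⟩
    · have h := congrArg Units.val haσ
      rwa [Units.coe_map, MonoidHom.coe_coe] at h
    · rw [hηapp, hmodU a ha1, inv_one, mul_one]
      exact hχa
  refine ⟨η, isQuadraticCharExtension_of_forall_norm_of_exists_fixed L v w hw η hN hx, ?_, ?_⟩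
  · have hcont : Continuous fun x : (LocalRing L v)ˣ => ((χ₁ x : ℂˣ) : ℂ) * (((halfModulusChar (LocalRing L v) x : ℂˣ) : ℂ))⁻¹ :=
      h₁.mul ((continuous_halfModulusChar_apply L v).inv₀ fun x => Units.ne_zero _)
    refine hcont.congr fun x => ?_
    rw [hηapp, Units.val_mul, Units.val_inv_eq_inv_val]
  · exact MonoidHom.ext fun x => by rw [MonoidHom.mul_apply, hηapp, inv_mul_cancel_right]

end Summit.HodgeConjecture.HodgeConjecture.R90.S1.BposRamConversion

end
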